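import Summits.Ventures.PercRepro.C025ProfileThinNonSimple

/-!
# C-025 AT `(q + 2, q)` WHEN THE SIMPLIFICATION IS THIN — loops and parallel classes are free (night-3 g17)
`C025ProfileThinNonSimple` proved C-025 at `(q + 2, q)` on every thin(q) matroid (every rank-`q` set has `≤ q + 1` points), using that
such a matroid has at most one loop or parallel pair.  This module removes that restriction altogether: only the SIMPLIFICATION has to
be thin.  The hypothesis (`SIMPLE-THIN(q)`): every rank-`q` set `X ⊆ E` in which every set of `≤ 2` points has full rank (no loop, no
parallel pair inside `X`) has at most `q + 1` points — i.e. every rank-`q` set contains at most `q + 1` pairwise non-parallel non-loop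
points.  Loops and parallel classes of any size are allowed.
* SIMPLE-THIN passes to every deletion at the same level (`simpleThin_delete`: ranks of sets avoiding `e` are unchanged) and to the
  contraction `M ／ {e}` by a non-loop `e` at level `q − 1` (`simpleThin_contract`: a rank-`(q−1)` set `X` of `M ／ {e}` whose pairs
  are independent gives the rank-`q` set `X ∪ {e}` of `M` whose pairs are independent — `ρ_M({a, e}) = ρ_{M/e}({a}) + 1 = 2`);
* on a simple matroid SIMPLE-THIN(q) is thin(q) (`thin_of_simpleThin`), and g16's `rls_succ_succ_thin_simple` applies;
* **`rls_succ_succ_simpleThin`**: for every `q ≥ 1` and every finite matroid with SIMPLE-THIN(q), `ThmN.RLS M (q + 2) q` — by strong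
  induction on `|E|` simultaneously in `q`: a loop halves (`RLS_of_loop_q`), a parallel pair is Theorem F (`RLS_of_parallel_q`) with the
  induction hypothesis on `M ＼ {e}` at `q` and on `M ／ {e}` at `q − 1`, the simple case is g16; at `q = 1` the row `(3, 1)` is
  p3's `c025_of_q_one` on every matroid.
No `def`, no `instance`, no notation.  Axioms: standard.
-/
open scoped Matroid
namespace PercRepro
open Set Finset ThmH Staged
namespace ThinGirth
variable {α : Type} [DecidableEq α] {M : Matroid α} [M.Finite]

omit [DecidableEq α] in
/-- The rank in `M ＼ {e}` of a `Finset` avoiding `e`, in `rkN` form. -/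
theorem rkN_delete_eq {e : α} {X : Finset α} (hX : (X : Set α) ⊆ M.E \ {e}) :
    rkN (M ＼ {e}) X = rkN M X := by
  rw [rkN_eq_iff, delete_singleton_eRk_eq hX, coe_rkN]

/-- The rank in `M ／ {e}` of a `Finset` avoiding `e`, `e` a non-loop, in `rkN` form: `ρ_{M/e}(X) + 1 = ρ_M(X ∪ {e})`. -/
theorem rkN_contract_add_one {e : α} (he : M.Indep {e}) {X : Finset α} (hX : (X : Set α) ⊆ M.E \ {e}) :
    rkN (M ／ {e}) X + 1 = rkN M (insert e X) := by
  have h := contract_singleton_eRk_add_one he hX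
  rw [← Finset.coe_insert, ← coe_rkN, ← coe_rkN, ← Nat.cast_succ, Nat.cast_inj] at h
  exact h

omit [DecidableEq α] in
/-- Contraction does not raise the rank of a set avoiding `e`. -/
theorem rkN_contract_le {e : α} (he : M.Indep {e}) {X : Finset α} (hX : (X : Set α) ⊆ M.E \ {e}) :
    rkN (M ／ {e}) X ≤ rkN M X := by
  classical
  have h1 := rkN_contract_add_one he hX
  have h2 : rkN M (insert e X) ≤ rkN M X + 1 := by
    have := M.eRk_insert_le_add_one e (X : Set α)
    rw [← Finset.coe_insert, ← coe_rkN, ← coe_rkN, ← Nat.cast_succ] at this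
    exact_mod_cast this
  omega

omit [DecidableEq α] in
/-- SIMPLE-THIN(q) passes to `M ＼ {e}`. -/
theorem simpleThin_delete {q : ℕ}
    (hthin : ∀ X ⊆ gr M, (∀ T ⊆ X, T.card ≤ 2 → rkN M T = T.card) → rkN M X = q → X.card ≤ q + 1) (e : α) :
    ∀ X ⊆ gr (M ＼ {e}), (∀ T ⊆ X, T.card ≤ 2 → rkN (M ＼ {e}) T = T.card) → rkN (M ＼ {e}) X = q →
      X.card ≤ q + 1 := by
  intro X hX hpair hXr
  have hXE : (X : Set α) ⊆ M.E \ {e} := by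
    rw [← Matroid.delete_ground, ← coe_gr]
    exact_mod_cast hX
  refine hthin X (subset_gr_of_coe_subset (hXE.trans Set.sdiff_subset)) ?_ ?_
  · intro T hT hTc
    have hTE : (T : Set α) ⊆ M.E \ {e} := (Finset.coe_subset.2 hT).trans hXE
    rw [← rkN_delete_eq hTE]
    exact hpair T hT hTc
  · rw [← rkN_delete_eq hXE]
    exact hXr

/-- SIMPLE-THIN(q + 1) passes to `M ／ {e}` at level `q`, `e` a non-loop. -/
theorem simpleThin_contract {q : ℕ}
    (hthin : ∀ X ⊆ gr M, (∀ T ⊆ X, T.card ≤ 2 → rkN M T = T.card) → rkN M X = q + 1 → X.card ≤ q + 2)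
    {e : α} (he : M.Indep {e}) :
    ∀ X ⊆ gr (M ／ {e}), (∀ T ⊆ X, T.card ≤ 2 → rkN (M ／ {e}) T = T.card) → rkN (M ／ {e}) X = q →
      X.card ≤ q + 1 := by
  intro X hX hpair hXr
  have hXE : (X : Set α) ⊆ M.E \ {e} := by
    rw [← Matroid.contract_ground, ← coe_gr]
    exact_mod_cast hX
  have heX : e ∉ X := fun h => (hXE (Finset.mem_coe.2 h)).2 rfl
  have heE : e ∈ M.E := he.subset_ground (mem_singleton e)
  have hXg : X ⊆ gr M := subset_gr_of_coe_subset (hXE.trans Set.sdiff_subset)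
  have h := hthin (insert e X) (Finset.insert_subset (mem_gr_of_mem_ground heE) hXg) ?_ ?_
  · rw [Finset.card_insert_of_notMem heX] at h
    omega
  · -- every set of `≤ 2` points of `X ∪ {e}` has full rank in `M`
    intro T hT hTc
    by_cases heT : e ∈ T
    · -- `T = insert e T₀` with `T₀ ⊆ X`, `|T₀| ≤ 1`: `ρ_M(T) = ρ_{M/e}(T₀) + 1 = |T₀| + 1`
      have hT₀ : T.erase e ⊆ X := by
        intro a ha
        rw [Finset.mem_erase] at ha
        have := hT ha.2
        rw [Finset.mem_insert] at this
        rcases this with h | h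
        · exact absurd h ha.1
        · exact h
      have hT₀E : ((T.erase e : Finset α) : Set α) ⊆ M.E \ {e} := (Finset.coe_subset.2 hT₀).trans hXE
      have hTe : insert e (T.erase e) = T := Finset.insert_erase heT
      rw [← hTe, ← rkN_contract_add_one he hT₀E, hpair _ hT₀ (by rw [Finset.card_erase_of_mem heT]; omega),
        Finset.card_insert_of_notMem (Finset.notMem_erase e T)]
    · have hTX : T ⊆ X := by
        intro a ha
        have := hT ha
        rw [Finset.mem_insert] at this
        rcases this with h | h
        · exact absurd (h ▸ ha) heT
        · exact h
      have hTE : (T : Set α) ⊆ M.E \ {e} := (Finset.coe_subset.2 hTX).trans hXE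
      have h1 := rkN_contract_le he hTE
      have h2 := hpair T hTX hTc
      have h3 : rkN M T ≤ T.card := rkN_le_card T
      omega
  · rw [← rkN_contract_add_one he hXE, hXr]

omit [DecidableEq α] in
/-- On a simple matroid, SIMPLE-THIN(q) is thin(q). -/
theorem thin_of_simpleThin {q : ℕ} (hsimple : ∀ T ⊆ M.E, T.encard ≤ 2 → M.Indep T)
    (hthin : ∀ X ⊆ gr M, (∀ T ⊆ X, T.card ≤ 2 → rkN M T = T.card) → rkN M X = q → X.card ≤ q + 1) :
    ∀ X ⊆ gr M, rkN M X = q → X.card ≤ q + 1 := by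
  intro X hXg hXr
  refine hthin X hXg ?_ hXr
  intro T hT hTc
  have hTE : (T : Set α) ⊆ M.E := by
    rw [← coe_gr]
    exact_mod_cast hT.trans hXg
  apply OneCircuit.rkN_eq_card_of_indep
  apply hsimple _ hTE
  rw [Set.encard_coe_eq_coe_finsetCard]
  exact_mod_cast hTc

/-- **C-025 AT `(q + 2, q)` WHEN THE SIMPLIFICATION IS THIN**: for every `q ≥ 1` and every finite matroid in which every rank-`q` set
whose pairs are independent has at most `q + 1` points (every rank-`q` set contains at most `q + 1` pairwise non-parallel non-loop
points), `ThmN.RLS M (q + 2) q`.  Strong induction on `|E|`: a loop halves, a parallel pair is Theorem F on `M ＼ {e}` at `q` and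
`M ／ {e}` at `q − 1`, the simple case is g16's `rls_succ_succ_thin_simple`; `q = 1` is p3's `c025_of_q_one`. -/
theorem rls_succ_succ_simpleThin :
    ∀ (q : ℕ), 1 ≤ q → ∀ (M : Matroid α) [M.Finite],
      (∀ X ⊆ gr M, (∀ T ⊆ X, T.card ≤ 2 → rkN M T = T.card) → rkN M X = q → X.card ≤ q + 1) →
      ThmN.RLS M (q + 2) q := by
  suffices H : ∀ n : ℕ, ∀ (M : Matroid α) [M.Finite], M.E.ncard = n → ∀ q : ℕ, 1 ≤ q →
      (∀ X ⊆ gr M, (∀ T ⊆ X, T.card ≤ 2 → rkN M T = T.card) → rkN M X = q → X.card ≤ q + 1) →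
      ThmN.RLS M (q + 2) q from fun q hq M _ hthin => H _ M rfl q hq hthin
  intro n
  induction n using Nat.strong_induction_on with
  | _ n ih =>
  intro M _ hn q hq hthin
  have hdel : ∀ e ∈ M.E, (M ＼ {e}).E.ncard < n := by
    intro e he
    rw [Matroid.delete_ground, ← hn, ← Set.ncard_sdiff_singleton_add_one he M.ground_finite]
    omega
  have hcon : ∀ e ∈ M.E, (M ／ {e}).E.ncard < n := by
    intro e he
    rw [Matroid.contract_ground, ← hn, ← Set.ncard_sdiff_singleton_add_one he M.ground_finite]
    omega
  -- `q = 1`: the row `(3, 1)` on every matroid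
  rcases Nat.lt_or_ge q 2 with hq1 | hq2
  · have hq' : q = 1 := by omega
    subst hq'
    unfold ThmN.RLS
    exact c025_of_q_one M 3
  -- a loop halves
  by_cases hloop : ∃ e, M.IsLoop e
  · obtain ⟨e, he⟩ := hloop
    exact ThmN.RLS_of_loop_q M he (q + 2) q
      (ih _ (hdel e he.mem_ground) (M ＼ {e}) rfl q hq (simpleThin_delete hthin e))
  have hnl : ∀ x ∈ M.E, M.Indep {x} := by
    intro x hx
    exact Matroid.indep_singleton.2 ((Matroid.not_isLoop_iff hx).1 (fun h => hloop ⟨x, h⟩))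
  -- simple: g16
  by_cases hsimple : ∀ T ⊆ M.E, T.encard ≤ 2 → M.Indep T
  · exact rls_succ_succ_thin_simple q hsimple (thin_of_simpleThin hsimple hthin)
  -- a parallel pair: Theorem F
  obtain ⟨e, e', heE, he'E, hne, hpar, _⟩ := exists_parallel_of_not_simple hnl hsimple
  have he : M.Indep {e} := hnl e heE
  obtain ⟨q', rfl⟩ : ∃ q', q = q' + 1 := ⟨q - 1, by omega⟩
  refine ThmN.RLS_of_parallel_q M (p := q' + 2) (q := q') he he'E hne hpar ?_ ?_
  · exact ih _ (hdel e heE) (M ＼ {e}) rfl (q' + 1) hq (simpleThin_delete hthin e)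
  · exact ih _ (hcon e heE) (M ／ {e}) rfl q' (by omega) (simpleThin_contract hthin he)

/-- C-025 at `(q + 2, q)` when the simplification is thin, for one matroid (the usual argument order). -/
theorem rls_succ_succ_of_simpleThin (q : ℕ) (hq : 1 ≤ q)
    (hthin : ∀ X ⊆ gr M, (∀ T ⊆ X, T.card ≤ 2 → rkN M T = T.card) → rkN M X = q → X.card ≤ q + 1) :
    ThmN.RLS M (q + 2) q :=
  rls_succ_succ_simpleThin q hq M hthin

end ThinGirth
end PercRepro
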